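import Summits.QuantumFields.YangMills.Theorems.LuscherReductionTwistedTraceScalingBTColourAveraging
import Summits.QuantumFields.YangMills.Theorems.LuscherReductionTwistedTraceScalingInnerStiffForm
import HarnessLib

/-!
# The DIAGONAL slow dependence of the magnetic phase is linear in the SAME colour vectors `slowLin u` — and every `Ad`-rotated linear functional averages to ZERO over the colour group
# (lane A of S-BASE, crux `TwistedTraceScaling` stmt-QuantumFields-20203, C4-CORE, the (B-T) pen (C′); design note `pub/ym-fleet/ym-luscher-20007-p1/COARSE-DESIGN.md` §25.7 (L3))

`…InnerStiffForm.abs_stiffForm_sub_le` (g11): `|‖D_uw‖² − ‖D_1w‖² − 2⟪D_1w, D'(slowLin u)w⟫| ≤ 1.45·10⁸·N·τ²‖w‖²` with `slowLin u k = 2u⁰_k·u⃗_k` — the magnetic phase on the tube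
(`…BTTubeMagnetic`) depends on the slow datum, to first order, through the LINEAR functional `c ↦ ⟪D_1w, D'(c)w⟫` of the colour vectors `c = slowLin u`, exactly as the kinetic phase does
(`…BTDiagonalKinetic`, same `c`).  This file supplies the averaging step for such functionals:
* §1 ★★ `integral_linear_adRot_eq_zero` — for EVERY `ℝ`-linear `Φ : (ι → ℝ³) → ℝ` and colour vectors `c`: `∫_g Φ(k ↦ Ad(g)c_k) dHaar(g) = 0` (continuity of `Φ`, `∫ Ad(g)a dg = 0` of
  `…BTColourAveraging`, componentwise);
* §2 `slowLin_conj` — `slowLin (dud⁻¹) k = Ad(d)·slowLin u k` (the colour vectors rotate with the slow datum);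
* §3 `covCurlLin_add_left`, `covCurlLin_smul_left`, the linear functional `stiffLinForm w : c ↦ ⟪D_1w, D'(c)w⟫`, and ★★ `integral_stiffLin_conj_eq_zero`:
  `∫_d ⟪D_1w, D'(slowLin (dud⁻¹)) w⟫ dd = 0` — the first-order magnetic slow dependence AVERAGES OUT under the colour rotation of `u`.
HONEST FRAMING: linear algebra + Haar averaging for a stub of a child of the CONDITIONAL reduction route R2b1; the Laplace core of (B-T) is OPEN; C4-CORE OPEN; not infinite volume, not a gap,
not Clay.
-/

set_option autoImplicit false

noncomputable section

open MeasureTheory Filter Topology Real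
open scoped BigOperators Matrix InnerProductSpace RealInnerProductSpace
open Literature.MathematicalPhysics.QuantumFieldTheory
open Literature.MathematicalPhysics.QuantumLattice

namespace Summit.QuantumFields.YangMills.Theorems.FemtoTransferGap.TwoLattice.ConstTube

open Summit.QuantumFields.YangMills.Theorems.FemtoTransferGap
open Summit.QuantumFields.YangMills.Theorems.FemtoTransferGap.TwoLattice
open Summit.QuantumFields.YangMills.Theorems.FemtoTransferGap.TwoLattice.Stiff
open Summit.QuantumFields.YangMills.Theorems.FemtoTransferGap.TwoLattice.Cov
open Summit.QuantumFields.YangMills.Theorems.FemtoTransferGap.TwoLattice.Toron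

variable {L : ℕ} [NeZero L]

/-! ## §1 ★★ Every `Ad`-rotated linear functional averages to zero -/

/-- The rotated colour vectors are integrable (continuous on a compact group). [folklore] -/
theorem integrable_adRot_family {ι : Type*} [Fintype ι] (c : ι → Fin 3 → ℝ) :
    Integrable (fun g : SU2 => fun k => (adRot g).mulVec (c k)) (haarProbability SU2) := by
  haveI : SecondCountableTopology SU2 := secondCountableTopology_su2
  have hc : Continuous fun g : SU2 => fun k => (adRot g).mulVec (c k) := continuous_pi fun k => continuous_adRot_mulVec (c k)
  refine Integrable.of_bound (C := ∑ k, (‖c k‖ * 3)) hc.aestronglyMeasurable (ae_of_all _ fun g => ?_)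
  refine (pi_norm_le_iff_of_nonneg (Finset.sum_nonneg fun k _ => by positivity)).mpr fun k => ?_
  have hk : ‖(adRot g).mulVec (c k)‖ ≤ ‖c k‖ * 3 := by
    refine (pi_norm_le_iff_of_nonneg (by positivity)).mpr fun i => ?_
    rw [Real.norm_eq_abs]
    have h1 : |(adRot g).mulVec (c k) i| ^ 2 ≤ ∑ j, ((adRot g).mulVec (c k) j) ^ 2 := by
      rw [sq_abs]; exact Finset.single_le_sum (f := fun j => ((adRot g).mulVec (c k) j) ^ 2) (fun j _ => sq_nonneg _) (Finset.mem_univ i)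
    rw [sum_sq_adRot_mulVec] at h1
    have h2 : ∑ j, c k j ^ 2 ≤ 3 * ‖c k‖ ^ 2 := by
      calc ∑ j, c k j ^ 2 ≤ ∑ _j : Fin 3, ‖c k‖ ^ 2 := Finset.sum_le_sum fun j _ => by
              rw [← sq_abs]; exact pow_le_pow_left₀ (abs_nonneg _) (by rw [← Real.norm_eq_abs]; exact norm_le_pi_norm (c k) j) 2
        _ = 3 * ‖c k‖ ^ 2 := by simp
    nlinarith [abs_nonneg ((adRot g).mulVec (c k) i), norm_nonneg (c k)]
  exact hk.trans (Finset.single_le_sum (f := fun k => ‖c k‖ * 3) (fun k _ => by positivity) (Finset.mem_univ k))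

/-- `∫_g (k ↦ Ad(g)c_k) dg = 0` as a vector of `ι → ℝ³`. [folklore] -/
theorem integral_adRot_family_eq_zero {ι : Type*} [Fintype ι] (c : ι → Fin 3 → ℝ) :
    ∫ g, (fun k => (adRot g).mulVec (c k)) ∂haarProbability SU2 = 0 := by
  funext k
  have h := (ContinuousLinearMap.proj (R := ℝ) (φ := fun _ : ι => Fin 3 → ℝ) k).integral_comp_comm (integrable_adRot_family c)
  simp only [ContinuousLinearMap.proj_apply] at h
  rw [← h, integral_adRot_mulVec_eq_zero]
  rfl

/-- ★★ **Every `Ad`-rotated LINEAR functional of colour vectors averages to zero**: `∫_g Φ(k ↦ Ad(g)c_k) dg = 0`. [cite: Luscher1983, §3] -/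
theorem integral_linear_adRot_eq_zero {ι : Type*} [Fintype ι] (Φ : (ι → Fin 3 → ℝ) →ₗ[ℝ] ℝ) (c : ι → Fin 3 → ℝ) :
    ∫ g, Φ (fun k => (adRot g).mulVec (c k)) ∂haarProbability SU2 = 0 := by
  have h := (LinearMap.toContinuousLinearMap Φ).integral_comp_comm (integrable_adRot_family c)
  simp only [LinearMap.coe_toContinuousLinearMap'] at h
  rw [h, integral_adRot_family_eq_zero, map_zero]

/-! ## §2 The colour vectors of the slow datum rotate with it -/

/-- `slowLin (dud⁻¹) k = Ad(d)·slowLin u k`. [folklore] -/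
theorem slowLin_conj (d : SU2) (u : GaugeConfig 3 1 SU2) (k : Fin 3) :
    slowLin (gaugeTransform (fun _ : Site 3 1 => d) u) k = (adRot d).mulVec (slowLin u k) := by
  unfold slowLin
  rw [gaugeTransform_const_apply', scalarPart_conj, vecPart_conj, Matrix.mulVec_smul]

/-! ## §3 The first-order magnetic functional and its colour average -/

omit [NeZero L] in
/-- `D'(c + c') = D'(c) + D'(c')`. [folklore] -/
theorem covCurlLin_add_left (c c' : Fin 3 → Fin 3 → ℝ) (w : LinkSpace L) : covCurlLin (c + c') w = covCurlLin c w + covCurlLin c' w := by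
  ext q
  obtain ⟨⟨x, ij⟩, a⟩ := q
  rw [PiLp.add_apply, covCurlLin_apply, covCurlLin_apply, covCurlLin_apply]
  simp only [Pi.add_apply, LinearMap.map_add₂]
  ring

omit [NeZero L] in
/-- `D'(t·c) = t·D'(c)`. [folklore] -/
theorem covCurlLin_smul_left (t : ℝ) (c : Fin 3 → Fin 3 → ℝ) (w : LinkSpace L) : covCurlLin (t • c) w = t • covCurlLin c w := by
  ext q
  obtain ⟨⟨x, ij⟩, a⟩ := q
  rw [PiLp.smul_apply, covCurlLin_apply, covCurlLin_apply]
  simp only [Pi.smul_apply, LinearMap.map_smul₂, smul_eq_mul]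
  ring

variable (L) in
/-- **The first-order magnetic functional** `c ↦ ⟪D_1w, D'(c)w⟫` (linear in the colour vectors). [cite: Luscher1983, §3] -/
def stiffLinForm (w : LinkSpace L) : (Fin 3 → Fin 3 → ℝ) →ₗ[ℝ] ℝ where
  toFun c := ⟪covCurl (1 : GaugeConfig 3 L SU2) w, covCurlLin c w⟫
  map_add' c c' := by rw [covCurlLin_add_left, inner_add_right]
  map_smul' t c := by rw [covCurlLin_smul_left, inner_smul_right]; rfl

/-- Unfolding `stiffLinForm`. [folklore] -/
theorem stiffLinForm_apply (w : LinkSpace L) (c : Fin 3 → Fin 3 → ℝ) : stiffLinForm L w c = ⟪covCurl (1 : GaugeConfig 3 L SU2) w, covCurlLin c w⟫ := rfl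

/-- ★★ **The first-order magnetic slow dependence averages out**: `∫_d ⟪D_1w, D'(slowLin (dud⁻¹))w⟫ dd = 0`. [cite: Luscher1983, §3] -/
theorem integral_stiffLin_conj_eq_zero (u : GaugeConfig 3 1 SU2) (w : LinkSpace L) :
    ∫ d, ⟪covCurl (1 : GaugeConfig 3 L SU2) w, covCurlLin (slowLin (gaugeTransform (fun _ : Site 3 1 => d) u)) w⟫ ∂haarProbability SU2 = 0 := by
  have h : ∀ d : SU2, ⟪covCurl (1 : GaugeConfig 3 L SU2) w, covCurlLin (slowLin (gaugeTransform (fun _ : Site 3 1 => d) u)) w⟫ =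
      stiffLinForm L w (fun k => (adRot d).mulVec (slowLin u k)) := fun d => by
    rw [stiffLinForm_apply]
    have hc : slowLin (gaugeTransform (fun _ : Site 3 1 => d) u) = fun k => (adRot d).mulVec (slowLin u k) := funext fun k => slowLin_conj d u k
    rw [hc]
  simp_rw [h]
  exact integral_linear_adRot_eq_zero (stiffLinForm L w) (slowLin u)

end Summit.QuantumFields.YangMills.Theorems.FemtoTransferGap.TwoLattice.ConstTube

end
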